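import Summits.Schanuel.Schanuel.Theorems.DiophantineDichotomyApproximationPropertyCycleAPIAt3DataThin
import Summits.Schanuel.Schanuel.Theorems.DiophantineDichotomyApproximationPropertyCycleAPIAt3SatelliteDichotomy
import HarnessLib

/-!
# Bézout for a rank-1 prime on a rank-2 prime of `ℚ[x₀, …, x₃]` cut by a form (stub `ideg_le_mul_of_rankOne`)

Crux `stmt-Schanuel-6117` (`Summit.Schanuel.Schanuel.Theses.DiophantineDichotomy.ApproximationProperty`),
line `orbit-interpolation-determinant`, registered support stub `ideg_le_mul_of_rankOne` (lead c13
sub-goal, KERNEL-c13 §1(a)): in the `t = 3` kernel an orbit `Z = V(𝔭)` (`𝔭` a homogeneous prime of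
`ℚ[x₀, …, x₃]` of rank `1`, a Galois orbit of `D = deg 𝔭 = ideg 𝔭 1` points) lies on a satellite
curve `C' = V(𝔮')` (`𝔮'` a homogeneous prime of rank `2`, of degree `δ' = ideg 𝔮' 2`). BÉZOUT: if a
form `g` of degree `m ≥ 1` not vanishing on `C'` (`g ∉ 𝔮'`) vanishes on the orbit (`g ∈ 𝔭`), then
`D ≤ δ' m`.

Proof (two steps, all ingredients landed; it is the proof of the landed `ideg_le_mul_of_rankTwo`
one rank down).
1. `𝔭` is a MINIMAL prime of `(𝔮', g)`: a minimal prime `𝔭₀ ≤ 𝔭` of `(𝔮', g)` exists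
   (`Ideal.exists_minimalPrimes_le`) and has `dim ℚ[x̲]/𝔭₀ = 1` (`minimalPrimes_cut_facts`, Krull's
   principal ideal theorem for the cut of the rank-`2` prime `𝔮'` by `g`), while
   `dim ℚ[x̲]/𝔭 = 1`; a strict inclusion `𝔭₀ < 𝔭` would give `1 + 1 ≤ 1`
   (`SatelliteDichotomy.ringKrullDim_quotient_add_one_le_of_lt`).
2. The `u`-resultant computation: over the finite set `𝓠` of minimal primes of `(𝔮', g)` the
   `u`-resultant of `g` over the generic hyperplane section of `V(𝔮')` is `c ∏_𝔮 F_𝔮^{e_𝔮}` with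
   `e_𝔮 ≥ 1` (`exists_uResultant_eq_C_mul_prod_pow`), the unmixed ideal `J` of the cycle has
   `deg J = Σ e_𝔮 deg 𝔮` (`exists_cycle_ideal`, Prop. 4.7 1)) and
   `deg J = deg_{u₁}(u-resultant) = deg 𝔮' · m` (`invariants_of_chowForm_eq_C_mul`,
   `blockDeg_uResultant`; Prop. 4.8 1), 4.11); hence `deg 𝔭 ≤ e_𝔭 deg 𝔭 ≤ Σ e_𝔮 deg 𝔮 = δ' m`.

Proofs only (no definitions, no named facts). Sources: Nesterenko–Philippon (eds.), LNM 1752 (2001),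
Ch. 3 §4 [cite: NesterenkoPhilippon2001, Ch. 3 Prop. 4.7 1), Prop. 4.8 1), Prop. 4.11 (pp. 39–41)].
-/

set_option linter.dupNamespace false

noncomputable section

attribute [local instance] MvPolynomial.gradedAlgebra

namespace Summit.Schanuel.Schanuel.Cruxes.ApproximationProperty.OrbitInterpolationDeterminant

open Literature.NumberTheory.Transcendental Literature.NumberTheory.Transcendental.Nesterenko MvPolynomial
open Literature.NumberTheory.Transcendental.PhilipponMain (ringKrullDim_quotient_eq_of_isUnmixedOfRank)
open scoped BigOperators

namespace IdegLeMulOfRankOneProof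

variable {𝔮' : Ideal (Rx 3)} {g : Rx 3} {m : ℕ}

/-- **A rank-1 prime over the cut `(𝔮', g)` is one of its minimal primes**: if `𝔮'` is a
homogeneous prime with `dim ℚ[x̲]/𝔮' = 2`, `g ∉ 𝔮'` a form, and `𝔭 ⊇ (𝔮', g)` is a prime with
`dim ℚ[x̲]/𝔭 = 1`, then `𝔭` is a minimal prime of `(𝔮', g)` (a minimal prime `𝔭₀ ≤ 𝔭` of the cut
has `dim = 1` by Krull's principal ideal theorem, and strict inclusions of primes lengthen chains).
[cite: NesterenkoPhilippon2001, Ch. 3 Prop. 4.11 (pp. 40–41)] -/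
theorem mem_minimalPrimes (h𝔮'prime : 𝔮'.IsPrime)
    (h𝔮'hom : 𝔮'.IsHomogeneous (homogeneousSubmodule (Fin (3 + 1)) ℚ))
    (h𝔮'unm : IsUnmixedOfRank 𝔮' 2) (hghom : g.IsHomogeneous m) (hg : g ∉ 𝔮')
    {𝔭 : Ideal (Rx 3)} (h𝔭prime : 𝔭.IsPrime) (h𝔭unm : IsUnmixedOfRank 𝔭 1) (hle : 𝔮' ≤ 𝔭)
    (hg𝔭 : g ∈ 𝔭) : 𝔭 ∈ (𝔮' ⊔ Ideal.span {g}).minimalPrimes := by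
  have hle' : 𝔮' ⊔ Ideal.span {g} ≤ 𝔭 :=
    sup_le hle ((Ideal.span_singleton_le_iff_mem _).mpr hg𝔭)
  obtain ⟨𝔭₀, h𝔭₀min, h𝔭₀le⟩ := Ideal.exists_minimalPrimes_le hle'
  obtain ⟨h𝔭₀prime, -, hdim₀, -, -⟩ :=
    minimalPrimes_cut_facts (r := 1 + 1) (by norm_num) h𝔮'prime h𝔮'hom h𝔮'unm hghom hg h𝔭₀min
  rw [Nat.add_sub_cancel] at hdim₀
  have hdim' : ringKrullDim (Rx 3 ⧸ 𝔭) = (1 : ℕ) :=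
    ringKrullDim_quotient_eq_of_isUnmixedOfRank h𝔭prime h𝔭unm
  -- `𝔭₀ = 𝔭`, since a strict inclusion would give `1 + 1 ≤ 1`
  have heq : 𝔭₀ = 𝔭 := by
    by_contra hne
    haveI := h𝔭₀prime
    have hlt : 𝔭₀ < 𝔭 := lt_of_le_of_ne h𝔭₀le hne
    have h := SatelliteDichotomy.ringKrullDim_quotient_add_one_le_of_lt hlt
    rw [hdim', hdim₀] at h
    have h' : (1 : ℕ) + 1 ≤ 1 := by exact_mod_cast h
    omega
  exact heq ▸ h𝔭₀min

/-- **Bézout over the cut `(𝔮', g)`**: with `𝔮'` a homogeneous prime with `dim ℚ[x̲]/𝔮' = 2` and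
`g ∉ 𝔮'` a form of degree `m ≥ 1`, every minimal prime `𝔭` of `(𝔮', g)` has
`deg 𝔭 ≤ deg 𝔮' · m` — the `u`-resultant of `g` over the generic hyperplane section of `V(𝔮')` is
`c ∏_𝔮 F_𝔮^{e_𝔮}` over the minimal primes (`e_𝔮 ≥ 1`), the unmixed ideal `J` of the cycle has
`deg J = Σ e_𝔮 deg 𝔮` (Prop. 4.7 1)) and `deg J = deg_{u₁}(u-resultant) = deg 𝔮' · m`
(Prop. 4.8 1), 4.11).
[cite: NesterenkoPhilippon2001, Ch. 3 Prop. 4.7 1), Prop. 4.8 1), Prop. 4.11 (pp. 39–41)] -/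
theorem ideg_le_of_mem_minimalPrimes (h𝔮'prime : 𝔮'.IsPrime)
    (h𝔮'hom : 𝔮'.IsHomogeneous (homogeneousSubmodule (Fin (3 + 1)) ℚ))
    (h𝔮'unm : IsUnmixedOfRank 𝔮' 2) (hghom : g.IsHomogeneous m) (hm : 1 ≤ m) (hg : g ∉ 𝔮')
    {𝔭 : Ideal (Rx 3)} (h𝔭min : 𝔭 ∈ (𝔮' ⊔ Ideal.span {g}).minimalPrimes) :
    ideg 𝔭 1 ≤ ideg 𝔮' 2 * m := by
  classical
  have h44 := NesterenkoPhilippon2001_ch3_prop_4_4_holds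
  have hg0 : g ≠ 0 := fun h => hg (h ▸ 𝔮'.zero_mem)
  -- the finite set of minimal primes of `(𝔮', g)`
  obtain ⟨𝓠, h𝓠, -⟩ := exists_finset_minimalPrimes_cut (𝔭 := 𝔮') h𝔮'hom h𝔮'prime.ne_top hghom hm
  have hmem : 𝔭 ∈ 𝓠 := by rw [← Finset.mem_coe, h𝓠]; exact h𝔭min
  -- a primitive integer model `g = p · g₀`
  obtain ⟨p, hp, g₀, hgg₀, hsupp, -⟩ := exists_eq_C_mul_map_primitive g hg0
  have hg₀ : g₀.IsHomogeneous m := by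
    intro e he
    have he' : e ∈ g.support := by rw [← hsupp]; exact mem_support_iff.mpr he
    exact hghom (mem_support_iff.mp he')
  -- the `u`-resultant factors over the minimal primes with positive exponents
  obtain ⟨c, hc, e, he, hG⟩ := exists_uResultant_eq_C_mul_prod_pow (s := 1) (by norm_num)
    (by norm_num) h𝔮'prime h𝔮'hom h𝔮'unm hghom hm hg hp hgg₀ hg₀ h𝓠
  -- the unmixed ideal of the cycle with these exponents: `deg J = Σ e_𝔮 deg 𝔮`
  obtain ⟨J, -, -, -, -, -, ⟨c₁, hc₁, hJF⟩, hdeg⟩ :=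
    exists_cycle_ideal h44 (r := 1 + 1) (by norm_num) (by norm_num) h𝔮'prime h𝔮'hom h𝔮'unm hghom
      hm hg h𝓠 e he
  rw [Nat.add_sub_cancel] at hJF hdeg
  -- and `deg J = deg_{u₁}(u-resultant) = deg 𝔮' · m`
  have hprod : ∏ 𝔮 ∈ 𝓠, chowForm 𝔮 1 ^ e 𝔮 = C c⁻¹ * uResultant 𝔮' 1 m g₀ := by
    rw [hG, ← mul_assoc, ← map_mul, inv_mul_cancel₀ hc, map_one, one_mul]
  rw [hprod, ← mul_assoc, ← map_mul] at hJF
  obtain ⟨hdegJ, -, -⟩ := invariants_of_chowForm_eq_C_mul (s := 1) (by norm_num)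
    (mul_ne_zero hc₁ (inv_ne_zero hc)) hJF
  have hbd : blockDeg (uResultant 𝔮' 1 m g₀) ⟨0, by norm_num⟩ = ideg 𝔮' 2 * m :=
    blockDeg_uResultant (s := 1) (by norm_num) (by norm_num) h𝔮'prime h𝔮'hom h𝔮'unm hghom hm hg hp
      hgg₀ hg₀
  have hsum : ∑ 𝔮 ∈ 𝓠, e 𝔮 * ideg 𝔮 1 = ideg 𝔮' 2 * m := by rw [← hdeg, hdegJ, hbd]
  calc ideg 𝔭 1 ≤ e 𝔭 * ideg 𝔭 1 := Nat.le_mul_of_pos_left _ (he 𝔭 hmem)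
    _ ≤ ∑ 𝔮 ∈ 𝓠, e 𝔮 * ideg 𝔮 1 :=
      Finset.single_le_sum (f := fun 𝔮 => e 𝔮 * ideg 𝔮 1) (fun _ _ => Nat.zero_le _) hmem
    _ = ideg 𝔮' 2 * m := hsum

end IdegLeMulOfRankOneProof

/-- **Registered stub `ideg_le_mul_of_rankOne`** (crux `stmt-Schanuel-6117`, line
`orbit-interpolation-determinant`, lead c13 sub-goal, KERNEL-c13 §1(a)): BÉZOUT for a rank-1 prime
on a rank-2 prime of `ℚ[x₀, …, x₃]` cut by a form — if `𝔮'` is a homogeneous prime with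
`dim ℚ[x̲]/𝔮' = 2` (a `ℚ`-curve of degree `ideg 𝔮' 2`) and `g ∉ 𝔮'` a form of degree `m ≥ 1`,
then every homogeneous prime `𝔭 ⊇ 𝔮'` with `dim ℚ[x̲]/𝔭 = 1` (an orbit of `ideg 𝔭 1` points)
containing `g` is a minimal prime of `(𝔮', g)` (`IdegLeMulOfRankOneProof.mem_minimalPrimes`) and
has `ideg 𝔭 1 ≤ ideg 𝔮' 2 · m` (`IdegLeMulOfRankOneProof.ideg_le_of_mem_minimalPrimes`). The
homogeneity hypothesis on `𝔭` is not used.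
[cite: NesterenkoPhilippon2001, Ch. 3 Prop. 4.7 1), Prop. 4.8 1), Prop. 4.11 (pp. 39–41)] -/
theorem ideg_le_mul_of_rankOne : ∀ (𝔮' : Ideal (Rx 3)) (g : Rx 3) (m : ℕ), 𝔮'.IsPrime → 𝔮'.IsHomogeneous (homogeneousSubmodule (Fin (3 + 1)) ℚ) → IsUnmixedOfRank 𝔮' 2 → g.IsHomogeneous m → 1 ≤ m → g ∉ 𝔮' → ∀ 𝔭 : Ideal (Rx 3), 𝔭.IsPrime → 𝔭.IsHomogeneous (homogeneousSubmodule (Fin (3 + 1)) ℚ) → IsUnmixedOfRank 𝔭 1 → 𝔮' ≤ 𝔭 → g ∈ 𝔭 → ideg 𝔭 1 ≤ ideg 𝔮' 2 * m := by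
  intro 𝔮' g m h𝔮'prime h𝔮'hom h𝔮'unm hghom hm hg 𝔭 h𝔭prime _ h𝔭unm hle hg𝔭
  exact IdegLeMulOfRankOneProof.ideg_le_of_mem_minimalPrimes h𝔮'prime h𝔮'hom h𝔮'unm hghom hm hg
    (IdegLeMulOfRankOneProof.mem_minimalPrimes h𝔮'prime h𝔮'hom h𝔮'unm hghom hg h𝔭prime h𝔭unm
      hle hg𝔭)

end Summit.Schanuel.Schanuel.Cruxes.ApproximationProperty.OrbitInterpolationDeterminant

end
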